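import Summits.CriticalPhenomena.CardyFormulaZ2.Theses.CardySelfRefinement
import Summits.CriticalPhenomena.CardyFormulaZ2.Theorems.CardySelfRefinementLagsToInvariance
import Summits.CriticalPhenomena.CardyFormulaZ2.Theorems.CardySelfRefinementTwoLagsAllLags
import HarnessLib

/-!
# Lag merging at the two lags `2` and `3` already gives the crux `ScaleInvariantLimits`
# (line `Sketch`, stmt-CriticalPhenomena-10265: the sharpest importable interface)

Line `Sketch` of the crux `ScaleInvariantLimits` (route `CardySelfRefinement`) lands the reduction
"lag merging for EVERY `k > 1` ⇒ crux" (`stub_scaleInvariantLimits_of_lags`).  With the route items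
`LagsToInvariance` (`dilateLaw_eq_self_of_lags`: merging at ONE lag `k` ⇒ `S_k`-invariance of every
subsequential limit) and `TwoLagsAllLags` (`twoLagsAllLags_proof`: `S_2`- and `S_3`-invariance ⇒
invariance under every `S_t`, closed-subgroup argument) both proved, the hypothesis shrinks to the
two lags `k = 2, 3`: **if for every finite family of quads the joint crossing probabilities of
critical bond-`ℤ²` percolation at meshes `2η`, `η` and at meshes `3η`, `η` merge as `η → 0⁺`, then
every subsequential scaling limit is dilation invariant.**  This is the target any future mechanism
for the crux has to hit (the route's Russo engine aims at exactly these two lags).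
-/

noncomputable section

open MeasureTheory Filter Set Topology
open Literature.Probability.Percolation Literature.Probability.Percolation.QuadCrossing
open Summit.CriticalPhenomena.CardyFormulaZ2.Theses.CardySelfRefinement

namespace Summit.CriticalPhenomena.CardyFormulaZ2.Theorems

/-- **Merging at lags `2` and `3` ⇒ the crux (unfolded).**  If the joint crossing probabilities
`μ_{kη} {∀ i, G i ∈ S} - μ_η {∀ i, G i ∈ S} → 0` (`η → 0⁺`) for `k = 2` and for `k = 3`, for every
finite family of quads `G`, then `dilateLaw t μ = μ` for every subsequential scaling limit `μ` and
every `t > 0`: `dilateLaw_eq_self_of_lags` at `k = 2, 3`, then `twoLagsAllLags_proof`. -/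
theorem stub_scaleInvariantLimits_of_lags_two_three
    (h2 : ∀ (m : ℕ) (G : Fin m → Quad (univ : Set ℂ)),
      Tendsto (fun η : ℝ =>
        (squareCrossingLaw (univ : Set ℂ) (2 * η) : Measure (QuadConfig (univ : Set ℂ))).real
            {S | ∀ i, G i ∈ S} -
          (squareCrossingLaw (univ : Set ℂ) η : Measure (QuadConfig (univ : Set ℂ))).real
            {S | ∀ i, G i ∈ S}) (𝓝[>] 0) (𝓝 0))
    (h3 : ∀ (m : ℕ) (G : Fin m → Quad (univ : Set ℂ)),
      Tendsto (fun η : ℝ =>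
        (squareCrossingLaw (univ : Set ℂ) (3 * η) : Measure (QuadConfig (univ : Set ℂ))).real
            {S | ∀ i, G i ∈ S} -
          (squareCrossingLaw (univ : Set ℂ) η : Measure (QuadConfig (univ : Set ℂ))).real
            {S | ∀ i, G i ∈ S}) (𝓝[>] 0) (𝓝 0))
    (μ : FiniteMeasure (QuadConfig (univ : Set ℂ))) (hμ : μ ∈ subseqQuadLimits (univ : Set ℂ))
    (t : ℝ) (ht : 0 < t) :
    dilateLaw t ht.ne' μ = μ :=
  twoLagsAllLags_proof
    (fun _ hν => ⟨dilateLaw_eq_self_of_lags two_pos h2 hν, dilateLaw_eq_self_of_lags three_pos h3 hν⟩)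
    μ hμ t ht

end Summit.CriticalPhenomena.CardyFormulaZ2.Theorems

end
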